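import Literature.NumberTheory.Weil1965.SiegelWeilNarrowRayBound
import HarnessLib

/-!
# The narrow-ray bound for a DOMINATED family (Weil's own route through Lemme 5 and positivity)

Topic `NumberTheory/Weil1965`; namespace `Literature.NumberTheory.Weil1964` (as the parent file).  KERNEL mathematics only
(theorems; no definition, no named fact, no `axiom`, no proof hole).

★ `SiegelWeilNarrowRayBound.exists_narrowRay_bound` ([Weil1965] n° 48 Lemmes 21–23, n° 50) bounds
`‖E(chirp(β•S) twist(a z(r)⁻¹) Φ)‖` UNIFORMLY over a family `𝔉` of test functions from TWO uniform data on `𝔉`: common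
decay data `(M, k, C_f)` (theta side) and a uniform adelic Gauss majorant `hE1` (Eisenstein side).  In Weil's own
argument the family is `𝔉 = {ω(S)Φ : S ∈ Ω}`, `Ω` compact, and the uniformity comes from Lemme 5 ([Weil1964] Chap. III
n° 41, p. 194): ONE `Φ₀ ∈ 𝒮(X_A)` with `|SΦ| ≤ Φ₀` — together with the POSITIVITY of the two measures `Î`, `E_X` that are
being evaluated.  This file proves that variant:

* `exists_narrowRay_bound_of_dominated` — same conclusion as ★ `exists_narrowRay_bound`, for EVERY `β ∈ 𝔸_F`, from:
  a real majorant `Φ₀ ∈ 𝒮(𝔸_F^m)` of the family (`‖Φ x‖ ≤ (Φ₀ x).re`, e.g. ★ `AdelicCompactFamilyDominated` ∕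
  ★ `AdelicImplementerFamilyDominated`), the decay data and the Gauss majorant (E1) of `Φ₀` ALONE, the sharp count (E3′)
  at `β = 0` alone, and MONOTONICITY of the Eisenstein functional `E_E` in the pointwise order
  (`‖Φ‖ ≤ re Ψ ⇒ ‖E_E Φ‖ ≤ ‖E_E Ψ‖` — automatic for a positive measure such as `E_X = Σ_b μ_b`).  The theta side needs
  no positivity hypothesis: ★ `hI` already bounds `‖E_I Φ‖` by ANY majorant of the tail sums, and the tails of `Φ` are
  termwise below those of `Φ₀`.  The chirp `chirp(β•S)` is unimodular and disappears from both sides, which is why no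
  uniformity in `β` is needed.

Cell hodgecm-mathlib, FLOOR 0, engine E-2 (crux item H413, `--supports stmt-HodgeConjecture-24833`), sheet
`SW2c-BOUND-ASSEMBLY.v0` §3 (B) with (DOM) in Lemme-5 form.  HC_CM is proved only modulo the printed citations until
rung 0 closes; nothing here is about Hodge classes.

## References
* [Weil1965] A. Weil, *Sur la formule de Siegel dans la théorie des groupes classiques*, Acta Math. 113 (1965) 1–87,
  n° 48 (Lemmes 21–23), n° 50.
* [Weil1964] A. Weil, *Sur certains groupes d'opérateurs unitaires*, Acta Math. 111 (1964) 143–211, Chap. III n° 41,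
  Lemme 5 p. 194.
-/

set_option autoImplicit false

noncomputable section

open scoped NNReal ENNReal Matrix Classical
open NumberField IsDedekindDomain MeasureTheory Matrix

namespace Literature.NumberTheory.Weil1964

open Literature.NumberTheory.Automorphic Literature.RepresentationTheory.HeisenbergGroup

variable (F : Type) [Field F] [NumberField F] {m : ℕ}
variable [MeasurableSpace (AdeleRing (𝓞 F) F)] [BorelSpace (AdeleRing (𝓞 F) F)]
variable (ν : Measure (Fin m → AdeleRing (𝓞 F) F)) [ν.IsAddHaarMeasure]

omit [MeasurableSpace (AdeleRing (𝓞 F) F)] [BorelSpace (AdeleRing (𝓞 F) F)] in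
/-- `|(chirp(β•S) twist(g) Φ)(x)| = |Φ(x g)|` (chirps are unimodular). [cite: Weil1964, Chap. III n° 41, Lemme 5 p. 194] -/
theorem norm_chirpLM_twistLM_apply (β : AdeleRing (𝓞 F) F) (S : Matrix (Fin m) (Fin m) (AdeleRing (𝓞 F) F))
    (g : GL (Fin m) (AdeleRing (𝓞 F) F)) (Φ : piSchwartzBruhat F (Fin m)) (x : Fin m → AdeleRing (𝓞 F) F) :
    ‖((chirpLM F (β • S) (twistLM F g Φ) : piSchwartzBruhat F (Fin m)) : (Fin m → AdeleRing (𝓞 F) F) → ℂ) x‖ =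
      ‖(Φ : (Fin m → AdeleRing (𝓞 F) F) → ℂ) (x ᵥ* (g : Matrix (Fin m) (Fin m) (AdeleRing (𝓞 F) F)))‖ := by
  rw [coe_chirpLM, coe_twistLM, norm_chirp_apply, twist_apply]

/-- **THE NARROW-RAY BOUND FOR A DOMINATED FAMILY** (Weil's route: Lemme 5 + positivity).  Compared with
★ `exists_narrowRay_bound`: the family `𝔉` carries no data of its own except a real Schwartz–Bruhat MAJORANT `Φ₀`
(`‖Φ x‖ ≤ (Φ₀ x).re` for `Φ ∈ 𝔉`); the decay data `(M, k, C_f)` and the adelic Gauss majorant (E1) are those of `Φ₀`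
alone; the count (E3′) is used at `β = 0` only; and the Eisenstein functional is MONOTONE (`hEEmono`).  Conclusion: for
EVERY `β ∈ 𝔸_F`, `a ∈ A`, `r ≤ 1`, `Φ ∈ 𝔉`, `‖E(chirp(β•S) twist(a z(r)⁻¹) Φ)‖ ≤ M_B · r^{m d/2}`.
[cite: Weil1965, n° 48 Lemmes 21–23 and n° 50] [cite: Weil1964, Chap. III n° 41, Lemme 5 p. 194] -/
theorem exists_narrowRay_bound_of_dominated (S : Matrix (Fin m) (Fin m) (AdeleRing (𝓞 F) F))
    (E EI EE : piSchwartzBruhat F (Fin m) →ₗ[ℂ] ℂ) (κ : ℝ≥0∞) (hκ : κ ≠ ⊤)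
    (hsplit : ∀ Φ : piSchwartzBruhat F (Fin m), (‖E Φ‖ₑ : ℝ≥0∞) ≤ ‖EI Φ‖ₑ + κ * ‖EE Φ‖ₑ)
    -- theta-type part
    {ι : Type*} (Ω : Set ι) (L : ι → GL (Fin m) (AdeleRing (𝓞 F) F)) (cI : ℝ≥0∞) (hcI : cI ≠ ⊤)
    (hI : ∀ (Φ : piSchwartzBruhat F (Fin m)) (B : ℝ≥0∞),
      (∀ h ∈ Ω, ∑' v : ↥{v : Fin m → F | v ≠ 0},
        (‖(Φ : (Fin m → AdeleRing (𝓞 F) F) → ℂ) (ratVec F (v : Fin m → F) ᵥ*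
          (L h : Matrix (Fin m) (Fin m) (AdeleRing (𝓞 F) F)))‖ₑ : ℝ≥0∞) ≤ B) → (‖EI Φ‖ₑ : ℝ≥0∞) ≤ cI * B)
    -- Eisenstein-type part (Fourier side) and its MONOTONICITY
    (hEE : ∀ Φ : piSchwartzBruhat F (Fin m), (‖EE Φ‖ₑ : ℝ≥0∞) ≤
      ∑' ξ : F, (‖∫ x, chirp F ((algebraMap F (AdeleRing (𝓞 F) F) ξ) • S)
        ((Φ : piSchwartzBruhat F (Fin m)) : (Fin m → AdeleRing (𝓞 F) F) → ℂ) x ∂ν‖ₑ : ℝ≥0∞))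
    (hEEmono : ∀ Φ Ψ : piSchwartzBruhat F (Fin m),
      (∀ x, ‖(Φ : (Fin m → AdeleRing (𝓞 F) F) → ℂ) x‖ ≤ ((Ψ : (Fin m → AdeleRing (𝓞 F) F) → ℂ) x).re) →
        (‖EE Φ‖ₑ : ℝ≥0∞) ≤ ‖EE Ψ‖ₑ)
    -- the family and its Schwartz–Bruhat majorant `Φ₀` with ITS decay data and Gauss majorant
    (𝔉 : Set (piSchwartzBruhat F (Fin m))) (Φ₀ : piSchwartzBruhat F (Fin m))
    (hdom : ∀ Φ ∈ 𝔉, ∀ x, ‖((Φ : piSchwartzBruhat F (Fin m)) : (Fin m → AdeleRing (𝓞 F) F) → ℂ) x‖ ≤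
      (((Φ₀ : piSchwartzBruhat F (Fin m)) : (Fin m → AdeleRing (𝓞 F) F) → ℂ) x).re)
    {M : ℝ} {k : ℕ} (hM0 : 0 ≤ M)
    (hdecay : ∀ x, ‖((Φ₀ : piSchwartzBruhat F (Fin m)) : (Fin m → AdeleRing (𝓞 F) F) → ℂ) x‖ ≤
      M * (1 + ‖vecInfinitePart F m x‖) ^ (-(k : ℝ)))
    {Cf : Set (Fin m → FiniteAdeleRing (𝓞 F) F)} (hCfc : IsCompact Cf)
    (hCf : ∀ x, vecFinitePart F m x ∉ Cf → ((Φ₀ : piSchwartzBruhat F (Fin m)) : (Fin m → AdeleRing (𝓞 F) F) → ℂ) x = 0)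
    {Nexp A₁ : ℝ} (hA₁ : 0 ≤ A₁)
    (hE1 : ∀ η : AdeleRing (𝓞 F) F,
      ‖∫ x, chirp F (η • S) ((Φ₀ : piSchwartzBruhat F (Fin m)) : (Fin m → AdeleRing (𝓞 F) F) → ℂ) x ∂ν‖ ≤
        A₁ * ((vecHeight F (![1, η] : Fin 2 → AdeleRing (𝓞 F) F) : ℝ≥0) : ℝ) ^ (-Nexp))
    -- the base twists: similitudes of `S` with compact finite parts, bounded height and bounded `|det|⁻¹`
    (A : Set (GL (Fin m) (AdeleRing (𝓞 F) F))) (u : GL (Fin m) (AdeleRing (𝓞 F) F) → AdeleRing (𝓞 F) F)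
    (hsim : ∀ a ∈ A, ((a⁻¹ : GL (Fin m) (AdeleRing (𝓞 F) F)) : Matrix (Fin m) (Fin m) (AdeleRing (𝓞 F) F)) * S *
      (((a⁻¹ : GL (Fin m) (AdeleRing (𝓞 F) F)) : Matrix (Fin m) (Fin m) (AdeleRing (𝓞 F) F)))ᵀ = u a • S)
    {𝒴 : Set (GL (Fin m) (FiniteAdeleRing (𝓞 F) F))} (h𝒴 : IsCompact 𝒴) {H₀ : ℝ} {D₀ : ℝ≥0}
    (hLA : ∀ h ∈ Ω, ∀ a ∈ A, GLn.sndHom m F (L h * a) ∈ 𝒴 ∧ (GLn.archHeight m F (L h * a) : ℝ) ≤ H₀)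
    (hdet : ∀ a ∈ A, (adelicAbsDet m F a)⁻¹ ≤ D₀)
    -- the sharp count (E3′) at `β = 0`
    (C₃ : ℝ≥0∞) (hC₃ : C₃ ≠ ⊤)
    (hE3 : ∀ a ∈ A, ∀ s : ℝ≥0ˣ, (s : ℝ≥0) ≤ 1 →
      ENNReal.ofReal (((s : ℝ≥0) : ℝ) ^ Module.finrank ℚ F) *
        ∑' ξ : F, ENNReal.ofReal (((vecHeight F (![1, algebraMap F (AdeleRing (𝓞 F) F) ξ * u a *
          ((posRealIdele F s : (AdeleRing (𝓞 F) F)ˣ) : AdeleRing (𝓞 F) F)] : Fin 2 → AdeleRing (𝓞 F) F) : ℝ≥0) : ℝ) ^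
            (-Nexp)) ≤ C₃)
    -- exponents
    (hm : 4 ≤ m) (hk : (m : ℝ) * Module.finrank ℚ F < k) :
    ∃ MB : ℝ≥0∞, MB ≠ ⊤ ∧ ∀ β : AdeleRing (𝓞 F) F, ∀ a ∈ A, ∀ r : ℝ≥0ˣ, (r : ℝ≥0) ≤ 1 → ∀ Φ ∈ 𝔉,
      (‖E (chirpLM F (β • S) (twistLM F (a * (posRealScalar m F r)⁻¹) Φ))‖ₑ : ℝ≥0∞) ≤
        MB * ENNReal.ofReal (((r : ℝ≥0) : ℝ) ^ ((m : ℝ) * Module.finrank ℚ F / 2)) := by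
  set d : ℕ := Module.finrank ℚ F with hd
  -- the theta tail constant (for the decay data of `Φ₀`)
  obtain ⟨BT, hBT, hT⟩ := exists_tsum_enorm_vecMul_tail_ray_le_uniform F (m := m) hM0 hCfc h𝒴 (θ := k) hk le_rfl
  set B₁ : ℝ≥0∞ := BT * ENNReal.ofReal ((max 1 ((m : ℝ) ^ 2 * max H₀ 0)) ^ (k : ℝ)) with hB₁
  have hB₁top : B₁ ≠ ⊤ := ENNReal.mul_ne_top hBT ENNReal.ofReal_ne_top
  refine ⟨cI * B₁ + κ * (ENNReal.ofReal ((D₀ : ℝ) * A₁) * C₃), ?_, fun β a ha r hr Φ hΦ => ?_⟩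
  · exact ENNReal.add_ne_top.2 ⟨ENNReal.mul_ne_top hcI hB₁top,
      ENNReal.mul_ne_top hκ (ENNReal.mul_ne_top ENNReal.ofReal_ne_top hC₃)⟩
  have hr0 : (0 : ℝ) < ((r : ℝ≥0) : ℝ) := NNReal.coe_pos.2 (Units.ne_zero r |>.bot_lt)
  have hr1 : ((r : ℝ≥0) : ℝ) ≤ 1 := by exact_mod_cast hr
  set g : GL (Fin m) (AdeleRing (𝓞 F) F) := a * (posRealScalar m F r)⁻¹ with hg
  set Φ' : piSchwartzBruhat F (Fin m) := chirpLM F (β • S) (twistLM F g Φ) with hΦ'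
  -- the comparison function on the Eisenstein side: `twist(g) Φ₀`
  set Ψ₀ : piSchwartzBruhat F (Fin m) := twistLM F g Φ₀ with hΨ₀
  -- pointwise: `|Φ'| ≤ re Ψ₀`
  have hptw : ∀ x, ‖((Φ' : piSchwartzBruhat F (Fin m)) : (Fin m → AdeleRing (𝓞 F) F) → ℂ) x‖ ≤
      (((Ψ₀ : piSchwartzBruhat F (Fin m)) : (Fin m → AdeleRing (𝓞 F) F) → ℂ) x).re := by
    intro x
    rw [hΦ', norm_chirpLM_twistLM_apply, hΨ₀, coe_twistLM, twist_apply]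
    exact hdom Φ hΦ _
  ------------------------------------------------------------------
  -- THETA SIDE: `‖EI Φ'‖ ≤ cI · r^k · B₁` (tails of `Φ` below tails of `Φ₀`)
  ------------------------------------------------------------------
  have hθside : (‖EI Φ'‖ₑ : ℝ≥0∞) ≤ cI * (ENNReal.ofReal (((r : ℝ≥0) : ℝ) ^ (k : ℝ)) * B₁) := by
    refine hI Φ' _ fun h hh => ?_
    have htail : ∑' v : ↥{v : Fin m → F | v ≠ 0},
        (‖(Φ' : (Fin m → AdeleRing (𝓞 F) F) → ℂ) (ratVec F (v : Fin m → F) ᵥ*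
          (L h : Matrix (Fin m) (Fin m) (AdeleRing (𝓞 F) F)))‖ₑ : ℝ≥0∞) ≤
        ∑' v : ↥{v : Fin m → F | v ≠ 0},
          (‖((Φ₀ : piSchwartzBruhat F (Fin m)) : (Fin m → AdeleRing (𝓞 F) F) → ℂ) (ratVec F (v : Fin m → F) ᵥ*
            ((L h * a * (posRealScalar m F r)⁻¹ : GL (Fin m) (AdeleRing (𝓞 F) F)) :
              Matrix (Fin m) (Fin m) (AdeleRing (𝓞 F) F)))‖ₑ : ℝ≥0∞) := by
      refine ENNReal.tsum_le_tsum fun v => ?_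
      rw [hΦ', ← ofReal_norm, ← ofReal_norm, norm_chirpLM_twistLM_apply, Matrix.vecMul_vecMul, hg, ← Units.val_mul,
        ← mul_assoc]
      refine ENNReal.ofReal_le_ofReal ((hdom Φ hΦ _).trans (Complex.re_le_norm _))
    refine htail.trans ?_
    obtain ⟨h𝒴a, hHa⟩ := hLA h hh a ha
    refine (hT _ hdecay hCf (L h * a) h𝒴a r).trans ?_
    refine mul_le_mul' le_rfl (mul_le_mul' le_rfl (ENNReal.ofReal_le_ofReal ?_))
    refine Real.rpow_le_rpow (le_trans zero_le_one (le_max_left _ _)) ?_ (Nat.cast_nonneg k)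
    exact max_le_max le_rfl (mul_le_mul_of_nonneg_left (hHa.trans (le_max_left _ _)) (by positivity))
  ------------------------------------------------------------------
  -- EISENSTEIN SIDE: `‖EE Φ'‖ ≤ ‖EE Ψ₀‖ ≤ (D₀ A₁ (r^d)^(m-2)) · C₃`
  ------------------------------------------------------------------
  have hr2le : ((r ^ 2 : ℝ≥0ˣ) : ℝ≥0) ≤ 1 := by
    rw [Units.val_pow_eq_pow_val]
    exact pow_le_one₀ bot_le hr
  have hEside : (‖EE Φ'‖ₑ : ℝ≥0∞) ≤
      ENNReal.ofReal ((D₀ : ℝ) * A₁ * (((r : ℝ≥0) : ℝ) ^ d) ^ (m - 2)) * C₃ := by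
    refine ((hEEmono Φ' Ψ₀ hptw).trans (hEE Ψ₀)).trans ?_
    -- `Ψ₀ = chirp(0•S) twist(g) Φ₀` as a function, to use the Borel-translate formula at `β = 0`
    have hcoe : ((Ψ₀ : (Fin m → AdeleRing (𝓞 F) F) → ℂ)) =
        chirp F ((0 : AdeleRing (𝓞 F) F) • S)
          (twist F g (((Φ₀ : piSchwartzBruhat F (Fin m)) : (Fin m → AdeleRing (𝓞 F) F) → ℂ))) := by
      rw [hΨ₀, coe_twistLM, zero_smul, chirp_zero_matrix]
    -- the `ξ`-th term
    have hterm : ∀ ξ : F,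
        (‖∫ x, chirp F ((algebraMap F (AdeleRing (𝓞 F) F) ξ) • S) ((Ψ₀ : (Fin m → AdeleRing (𝓞 F) F) → ℂ)) x ∂ν‖ₑ :
          ℝ≥0∞) ≤
        ENNReal.ofReal ((D₀ : ℝ) * A₁ * (((r : ℝ≥0) : ℝ) ^ d) ^ m) *
          ENNReal.ofReal (((vecHeight F (![1, algebraMap F (AdeleRing (𝓞 F) F) ξ * u a *
            ((posRealIdele F (r ^ 2) : (AdeleRing (𝓞 F) F)ˣ) : AdeleRing (𝓞 F) F)] : Fin 2 → AdeleRing (𝓞 F) F) :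
              ℝ≥0) : ℝ) ^ (-Nexp)) := by
      intro ξ
      rw [hcoe, hg, integral_chirp_smul_borelTranslate F ν _ 0 S a (hsim a ha) r, add_zero, enorm_smul,
        Real.enorm_eq_ofReal (NNReal.coe_nonneg _)]
      have hW := hE1 (algebraMap F (AdeleRing (𝓞 F) F) ξ * u a *
        ((posRealIdele F (r ^ 2) : (AdeleRing (𝓞 F) F)ˣ) : AdeleRing (𝓞 F) F))
      have hIn : (‖∫ x, chirp F ((algebraMap F (AdeleRing (𝓞 F) F) ξ * u a *
          ((posRealIdele F (r ^ 2) : (AdeleRing (𝓞 F) F)ˣ) : AdeleRing (𝓞 F) F)) • S)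
          (((Φ₀ : piSchwartzBruhat F (Fin m)) : (Fin m → AdeleRing (𝓞 F) F) → ℂ)) x ∂ν‖ₑ : ℝ≥0∞) ≤
          ENNReal.ofReal (A₁ * ((vecHeight F (![1, algebraMap F (AdeleRing (𝓞 F) F) ξ * u a *
            ((posRealIdele F (r ^ 2) : (AdeleRing (𝓞 F) F)ˣ) : AdeleRing (𝓞 F) F)] : Fin 2 → AdeleRing (𝓞 F) F) :
              ℝ≥0) : ℝ) ^ (-Nexp)) := by
        rw [← ofReal_norm]
        exact ENNReal.ofReal_le_ofReal hW
      have hc : ((((r : ℝ≥0) ^ d) ^ m * (adelicAbsDet m F a)⁻¹ : ℝ≥0) : ℝ) ≤ (((r : ℝ≥0) : ℝ) ^ d) ^ m * (D₀ : ℝ) := by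
        rw [NNReal.coe_mul, NNReal.coe_pow, NNReal.coe_pow]
        exact mul_le_mul_of_nonneg_left (NNReal.coe_le_coe.2 (hdet a ha)) (by positivity)
      calc ENNReal.ofReal ((((r : ℝ≥0) ^ d) ^ m * (adelicAbsDet m F a)⁻¹ : ℝ≥0) : ℝ) *
            (‖∫ x, chirp F ((algebraMap F (AdeleRing (𝓞 F) F) ξ * u a *
              ((posRealIdele F (r ^ 2) : (AdeleRing (𝓞 F) F)ˣ) : AdeleRing (𝓞 F) F)) • S)
              (((Φ₀ : piSchwartzBruhat F (Fin m)) : (Fin m → AdeleRing (𝓞 F) F) → ℂ)) x ∂ν‖ₑ : ℝ≥0∞)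
          ≤ ENNReal.ofReal ((((r : ℝ≥0) : ℝ) ^ d) ^ m * (D₀ : ℝ)) *
              ENNReal.ofReal (A₁ * ((vecHeight F (![1, algebraMap F (AdeleRing (𝓞 F) F) ξ * u a *
                ((posRealIdele F (r ^ 2) : (AdeleRing (𝓞 F) F)ˣ) : AdeleRing (𝓞 F) F)] : Fin 2 → AdeleRing (𝓞 F) F) :
                  ℝ≥0) : ℝ) ^ (-Nexp)) :=
            mul_le_mul' (ENNReal.ofReal_le_ofReal hc) hIn
        _ = _ := by
            rw [ENNReal.ofReal_mul hA₁, ← mul_assoc, ← ENNReal.ofReal_mul (by positivity)]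
            congr 2
            ring
    calc ∑' ξ : F, (‖∫ x, chirp F ((algebraMap F (AdeleRing (𝓞 F) F) ξ) • S)
            ((Ψ₀ : (Fin m → AdeleRing (𝓞 F) F) → ℂ)) x ∂ν‖ₑ : ℝ≥0∞)
        ≤ ∑' ξ : F, ENNReal.ofReal ((D₀ : ℝ) * A₁ * (((r : ℝ≥0) : ℝ) ^ d) ^ m) *
            ENNReal.ofReal (((vecHeight F (![1, algebraMap F (AdeleRing (𝓞 F) F) ξ * u a *
              ((posRealIdele F (r ^ 2) : (AdeleRing (𝓞 F) F)ˣ) : AdeleRing (𝓞 F) F)] : Fin 2 → AdeleRing (𝓞 F) F) :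
                ℝ≥0) : ℝ) ^ (-Nexp)) := ENNReal.tsum_le_tsum hterm
      _ = ENNReal.ofReal ((D₀ : ℝ) * A₁ * (((r : ℝ≥0) : ℝ) ^ d) ^ (m - 2)) *
            (ENNReal.ofReal ((((r ^ 2 : ℝ≥0ˣ) : ℝ≥0) : ℝ) ^ Module.finrank ℚ F) *
              ∑' ξ : F, ENNReal.ofReal (((vecHeight F (![1, algebraMap F (AdeleRing (𝓞 F) F) ξ * u a *
                ((posRealIdele F (r ^ 2) : (AdeleRing (𝓞 F) F)ˣ) : AdeleRing (𝓞 F) F)] : Fin 2 → AdeleRing (𝓞 F) F) :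
                  ℝ≥0) : ℝ) ^ (-Nexp))) := by
          rw [ENNReal.tsum_mul_left, ← mul_assoc, ← ENNReal.ofReal_mul (by positivity)]
          congr 2
          rw [Units.val_pow_eq_pow_val, NNReal.coe_pow, ← hd]
          have hm2 : m = (m - 2) + 2 := (Nat.sub_add_cancel (le_trans (by norm_num) hm)).symm
          conv_lhs => rw [hm2]
          ring
      _ ≤ ENNReal.ofReal ((D₀ : ℝ) * A₁ * (((r : ℝ≥0) : ℝ) ^ d) ^ (m - 2)) * C₃ :=
          mul_le_mul' le_rfl (hE3 a ha (r ^ 2) hr2le)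
  ------------------------------------------------------------------
  -- COMBINATION (verbatim as in the parent file)
  ------------------------------------------------------------------
  have hmd2k : (m : ℝ) * d / 2 ≤ (k : ℝ) := by
    have : (0 : ℝ) ≤ (m : ℝ) * d := by positivity
    linarith
  have hmd2m2 : (m : ℝ) * d / 2 ≤ ((d * (m - 2) : ℕ) : ℝ) := by
    rw [Nat.cast_mul, Nat.cast_sub (le_trans (by norm_num) hm)]
    have hm' : (4 : ℝ) ≤ m := by exact_mod_cast hm
    have hd0 : (0 : ℝ) ≤ d := Nat.cast_nonneg d
    nlinarith
  have hpow1 : ((r : ℝ≥0) : ℝ) ^ (k : ℝ) ≤ ((r : ℝ≥0) : ℝ) ^ ((m : ℝ) * Module.finrank ℚ F / 2) := by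
    rw [← hd]
    exact Real.rpow_le_rpow_of_exponent_ge hr0 hr1 hmd2k
  have hpow2 : (((r : ℝ≥0) : ℝ) ^ d) ^ (m - 2) ≤ ((r : ℝ≥0) : ℝ) ^ ((m : ℝ) * Module.finrank ℚ F / 2) := by
    rw [← pow_mul, ← Real.rpow_natCast, ← hd]
    exact Real.rpow_le_rpow_of_exponent_ge hr0 hr1 hmd2m2
  calc (‖E Φ'‖ₑ : ℝ≥0∞) ≤ ‖EI Φ'‖ₑ + κ * ‖EE Φ'‖ₑ := hsplit Φ'
    _ ≤ cI * (ENNReal.ofReal (((r : ℝ≥0) : ℝ) ^ (k : ℝ)) * B₁) +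
          κ * (ENNReal.ofReal ((D₀ : ℝ) * A₁ * (((r : ℝ≥0) : ℝ) ^ d) ^ (m - 2)) * C₃) :=
        add_le_add hθside (mul_le_mul' le_rfl hEside)
    _ ≤ cI * (ENNReal.ofReal (((r : ℝ≥0) : ℝ) ^ ((m : ℝ) * Module.finrank ℚ F / 2)) * B₁) +
          κ * (ENNReal.ofReal ((D₀ : ℝ) * A₁ * ((r : ℝ≥0) : ℝ) ^ ((m : ℝ) * Module.finrank ℚ F / 2)) * C₃) := by
        gcongr
    _ = (cI * B₁ + κ * (ENNReal.ofReal ((D₀ : ℝ) * A₁) * C₃)) *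
          ENNReal.ofReal (((r : ℝ≥0) : ℝ) ^ ((m : ℝ) * Module.finrank ℚ F / 2)) := by
        rw [ENNReal.ofReal_mul (by positivity : (0 : ℝ) ≤ (D₀ : ℝ) * A₁)]
        ring

end Literature.NumberTheory.Weil1964
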